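/-
Copyright (c) 2026 the pub-hodgecm-mathlib formalisation cell (harness21).  Prover seat hodgecm-mathlib-K2E1-p10 (g5), Track B «K2-LIT», h413 = `stmt-HodgeConjecture-24833`,
R90-TF section S8 «ContSpec-n½», deal S8-R195 (i) «hCONT OF RECORD» (S8 dealer R90-CS-plan (g3)): the `hCONT` ROW of the (R)′ OF RECORD head ★ `res_midBlock_le_residual_of_record`
(K2E1-p12, `R90S8ResGMidBlockLeResidualOfRecordU3` :135–:147) BYTE FOR BYTE, from ONE per-generator row «exports with the truncated family + χ pole ledger» via ★ (C4)
`hCONT_of_truncatedFamily_exports`; census + structural finding F1 on the bus 01:10Z (the row quantifies over EVERY `(K′, ω)`; exports are ★ only at admissible levels).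
-/
import Summits.HodgeConjecture.HodgeConjecture.Theorems.R90S8ResGMidBlockHContOfExportsU3   -- ★ (C4) p863961 (this seat): `hCONT_of_truncatedFamily_exports`; brings the S8 frame
import Summits.HodgeConjecture.HodgeConjecture.Theorems.R90S8ResGMidAtomU3Defs              -- ★ p862682 (K2E1-p11): `resGMidAtomGen` currency — `chiSectionSpacePair`, `OneDimAutRepH`, the block characters
import HarnessLib

/-!
# R90-TF · S8 «ContSpec-n½» — `R90S8ResGMidBlockHContOfRecordU3` (deal S8-R195 (i)): THE `hCONT` ROW OF THE (R)′ OF RECORD, FROM ONE PER-GENERATOR ROW «EXPORTS WITH THE TRUNCATED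
# FAMILY + χ POLE LEDGER»

Cell `hodgecm-mathlib`, crux H413 (`stmt-HodgeConjecture-24833`, lane `--supports … --as helper`), route of record `HCCMUnconditional`; R90-TF section S8.  THEOREMS ONLY (no `def`, no
`instance`, no notation, no named-fact hypothesis, no `sorry`; default heartbeats); count-neutral; CLOSES NO SOCKET.  WHAT.  ★ (R)′ OF RECORD `res_midBlock_le_residual_of_record`
(K2E1-p12) carries, at the socket frame `(L μ μω ξ)`, the row `hCONT` (:135–:147): for EVERY generator datum `(K′, ω, φ, Ec, Sp, Fp, f)` of ★ D1 `resGMidAtomGen` and every normalised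
Heisenberg package `(ν, 𝓕)`, ONE truncation level `T ≥ 1`, a finite real exceptional set `S` and an `L²(𝔛, μ)`-holomorphic family on `{1 < Re} ∖ (Sp ∪ S)` representing `Λ^T(Ec z)`.
★ (C4) `hCONT_of_truncatedFamily_exports` pays that conclusion for ONE generator from the exports' continuation `Ec′` at `φ` WITH the truncated family (★ (C2b), conjunct (E6)) and the χ
pole ledger `P ∩ {1 < Re} ⊆ S`.  This file states the per-generator input as ONE ∀-row `hEXP6` IN THE (R)′ HEAD's QUANTIFIER ORDER and derives the `hCONT` row from it, so that the
(R)′ consumer writes `hCONT := hCONT_row_of_exportsRow L μ μω ξ hEXP6`.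
STRUCTURAL FINDING F1 (bus 01:10Z, honest): `hEXP6` — like `hCONT`, `hEXP`, `hSCALrows` themselves — quantifies over EVERY subgroup `K′` and EVERY hom `ω` (★ D1 `resGMidBlock` is the
closed `G(𝔸)`-span of the atoms over ALL `(K′, ω)`, and `chiSectionSpacePair` carries no level condition), whereas every ★ export head (★ row 8 LEVEL `_with_truncatedFamily`, ★
`chiPair_exports_of_witness`) needs an ADMISSIBLE level package (`K′ ≤ K_max`, `ι(K_∞) ⊆ K′`, an open compact `U₀` with `ω = 1`, a finite continuous bounded basis of `V(χʷ, K′, ω)`).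
So `hEXP6` is dischargeable today generator-by-generator at admissible levels only; the dealer∕LEAD rule on the cut (restrict the union in D1 to admissible levels, or a reduction lemma
«arbitrary atoms lie in the closed span of admissible atoms»).
* §1 **`hCONT_row_of_exportsRow`** — the (R)′ :135–:147 row from `hEXP6` (★ (C4) per generator, `T := 1`, the ledger's `S`).
* §2 (ED. 2, rulings S8-R197 (O3)-as-letter ∕ S8-R199 τ-admissible) **`hCONT_admissible_row_of_exportsRow`** — the SAME derivation with both ∀-rows RESTRICTED to the generators
  satisfying an admissibility predicate `Adm K′ ω φ` (one extra binder `(_ : Adm K' ω φ)` after `φ`): the `hCONT` row of ★ `res_midBlock_le_residual_of_admissible`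
  (`R90S8ResGMidBlockLeResidualOfAdmissibleU3`) from the admissible exports row `hEXP6`.
HONEST LABEL: HC_CM is proved only modulo the 7 printed citations (2 remaining named inputs: hLiu418 = `stmt-HodgeConjecture-24832`, h413 = `stmt-HodgeConjecture-24833`) until rung 0
closes; this file asserts no named fact and closes no socket; `hEXP6` is a visible letter (exports of record per generator + χ pole ledger), unpaid at non-admissible levels (F1).

## References
* [MoeglinWaldspurger1995] C. Mœglin, J.-L. Waldspurger, *Spectral Decomposition and Eisenstein Series* (1995), IV.1.9–IV.1.11, IV.2.3, V.3.13.
* [BernsteinLapid2019] J. Bernstein, E. Lapid, *On the meromorphic continuation of Eisenstein series*, J. AMS 37 (2024), Thm 2.3, §4.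
* [Rogawski1990] J. D. Rogawski, *Automorphic Representations of Unitary Groups in Three Variables* (1990), §13.9 p. 229 (ii).
-/

set_option autoImplicit false
set_option linter.dupNamespace false  -- the mandated namespace `…HodgeConjecture.HodgeConjecture.R90.S8` repeats the summit's segment

noncomputable section

open MeasureTheory Measure NumberField IsDedekindDomain Set Filter Topology
open scoped ENNReal NNReal
open Literature.NumberTheory Literature.NumberTheory.Automorphic Literature.NumberTheory.Automorphic.UnitaryGroup Literature.NumberTheory.GaloisRepresentations AdelicGroupData
open Literature.NumberTheory.Automorphic.Arthur2013.Leaves.TECR Literature.NumberTheory.Rogawski1990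
open Summit.HodgeConjecture.HodgeConjecture.Cruxes.H413.K2E1BorelEisensteinU
open Summit.HodgeConjecture.HodgeConjecture.Cruxes.H413.K2E1CharacterEisensteinU3PairDefs Summit.HodgeConjecture.HodgeConjecture.Cruxes.H413.K2E1ChiSectionSpaceU3PairDefs

namespace Summit.HodgeConjecture.HodgeConjecture.R90.S8

variable (L : Type) [Field L] [NumberField L] [IsCMField L]
  [MeasurableSpace (quasiSplit (↥(maximalRealSubfield L)) L (IsCMField.complexConj L) 3).Adelic]

/-- **THE `hCONT` ROW OF THE (R)′ OF RECORD FROM ONE PER-GENERATOR EXPORTS ROW** (★ `res_midBlock_le_residual_of_record` :135–:147, byte for byte): given, for every generator datum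
`(K′, ω, φ)` of the block of `ξ` and every normalised Heisenberg package `(ν, 𝓕)`, the exports' continuation `Ec′` of `E(f^φ)` with a pole set `P`, a finite real `S ⊇ P ∩ {1<Re}`
(the χ pole ledger), holomorphy off `P`, the tube identity and (E6) (★ (C2b) `…_with_truncatedFamily`), the row `hCONT` holds — per generator ★ (C4) `hCONT_of_truncatedFamily_exports`
(`T := 1`, the ledger's `S`, `Ec = Ec′` on the slit domain by the identity theorem).  F1 (module docstring): `hEXP6` is ★-payable only at admissible levels.
[cite: MoeglinWaldspurger1995, IV.1.11, IV.2.3, V.3.13] [cite: BernsteinLapid2019, Thm 2.3, §4] [cite: Rogawski1990, §13.9 p. 229 (ii)] -/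
theorem hCONT_row_of_exportsRow
    (μ : Measure (quasiSplit (↥(maximalRealSubfield L)) L (IsCMField.complexConj L) 3).automorphicQuotient) [(quasiSplit (↥(maximalRealSubfield L)) L (IsCMField.complexConj L) 3).IsAutomorphicMeasure μ]
    (μω : HeckeCharacter L) (ξ : OneDimAutRepH L)
    (hEXP6 : ∀ (K' : Subgroup (quasiSplit (↥(maximalRealSubfield L)) L (IsCMField.complexConj L) 3).Adelic) (ω : ↥K' →* ℂ)
      (φ : (quasiSplit (↥(maximalRealSubfield L)) L (IsCMField.complexConj L) 3).Adelic → ℂ) (_ : φ ∈ chiSectionSpacePair (ξ.bcη⁻¹ * ξ.bcψ⁻¹ * μω) ξ.ψ K' (ω : ↥K' → ℂ)) (_ : Continuous φ)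
      (ν : Measure ↥(adelicUnipotent (↥(maximalRealSubfield L)) L (IsCMField.complexConj L) 3)) (_ : ν.IsHaarMeasure) (𝓕 : Set ↥(adelicUnipotent (↥(maximalRealSubfield L)) L (IsCMField.complexConj L) 3))
      (_ : IsFundamentalDomain ↥(rationalUnipotent (↥(maximalRealSubfield L)) L (IsCMField.complexConj L) 3) 𝓕 ν) (_ : IsCompact (closure 𝓕)) (_ : ν.IsInvInvariant) (_ : ν 𝓕 = 1),
      ∃ (Ec' : ℂ → (quasiSplit (↥(maximalRealSubfield L)) L (IsCMField.complexConj L) 3).Adelic → ℂ) (P : Set ℂ) (S : Finset ℂ), (∀ s ∈ S, s.im = 0) ∧ P ∩ {z : ℂ | 1 < z.re} ⊆ (↑S : Set ℂ) ∧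
        (∀ g, DifferentiableOn ℂ (fun z => Ec' z g) Pᶜ) ∧ (∀ z : ℂ, 2 < z.re → Ec' z = eisensteinSeriesU (flatSectionU φ z)) ∧
        (∀ T : ℝ≥0, 1 ≤ T → ∃ Fam : ℂ → Lp ℂ 2 μ, DifferentiableOn ℂ Fam Pᶜ ∧
          ∀ z : ℂ, z ∉ P → ((Fam z : Lp ℂ 2 μ) : (quasiSplit (↥(maximalRealSubfield L)) L (IsCMField.complexConj L) 3).automorphicQuotient → ℂ) =ᵐ[μ] (quasiSplit (↥(maximalRealSubfield L)) L (IsCMField.complexConj L) 3).quotFun (truncation ν 𝓕 T (Ec' z)))) :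
    ∀ (K' : Subgroup (quasiSplit (↥(maximalRealSubfield L)) L (IsCMField.complexConj L) 3).Adelic) (ω : ↥K' →* ℂ)
      (φ : (quasiSplit (↥(maximalRealSubfield L)) L (IsCMField.complexConj L) 3).Adelic → ℂ) (_ : φ ∈ chiSectionSpacePair (ξ.bcη⁻¹ * ξ.bcψ⁻¹ * μω) ξ.ψ K' (ω : ↥K' → ℂ)) (_ : Continuous φ)
      (Ec : ℂ → (quasiSplit (↥(maximalRealSubfield L)) L (IsCMField.complexConj L) 3).Adelic → ℂ) (Sp : Finset ℂ) (_ : ∀ s ∈ Sp, s.im = 0 ∧ 1 < s.re ∧ s.re ≤ 2)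
      (_ : ∀ g, DifferentiableOn ℂ (fun z => Ec z g) ({z : ℂ | 1 < z.re} \ (↑Sp : Set ℂ)))
      (_ : ∀ z : ℂ, 2 < z.re → Ec z = eisensteinSeriesU (flatSectionU φ z))
      (Fp : (quasiSplit (↥(maximalRealSubfield L)) L (IsCMField.complexConj L) 3).Adelic → ℂ → ℂ) (_ : ∀ g, AnalyticAt ℂ (Fp g) ((3 : ℂ) / 2))
      (_ : ∀ g, Fp g =ᶠ[𝓝[≠] ((3 : ℂ) / 2)] fun z => (z - (3 : ℂ) / 2) * Ec z g)
      (f : (quasiSplit (↥(maximalRealSubfield L)) L (IsCMField.complexConj L) 3).L2 μ) (_ : (f : (quasiSplit (↥(maximalRealSubfield L)) L (IsCMField.complexConj L) 3).automorphicQuotient → ℂ) =ᵐ[μ] fun x => Fp (Quotient.out (x : (quasiSplit (↥(maximalRealSubfield L)) L (IsCMField.complexConj L) 3).Adelic ⧸ (quasiSplit (↥(maximalRealSubfield L)) L (IsCMField.complexConj L) 3).quotientSubgroup))⁻¹ ((3 : ℂ) / 2))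
      (ν : Measure ↥(adelicUnipotent (↥(maximalRealSubfield L)) L (IsCMField.complexConj L) 3)) (_ : ν.IsHaarMeasure) (𝓕 : Set ↥(adelicUnipotent (↥(maximalRealSubfield L)) L (IsCMField.complexConj L) 3)) (_ : IsFundamentalDomain ↥(rationalUnipotent (↥(maximalRealSubfield L)) L (IsCMField.complexConj L) 3) 𝓕 ν) (_ : IsCompact (closure 𝓕)) (_ : ν.IsInvInvariant) (_ : ν 𝓕 = 1),
      ∃ (T : ℝ≥0) (_ : 1 ≤ T) (S : Finset ℂ) (_ : ∀ s ∈ S, s.im = 0) (Fam : ℂ → (quasiSplit (↥(maximalRealSubfield L)) L (IsCMField.complexConj L) 3).L2 μ),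
        DifferentiableOn ℂ Fam ({z : ℂ | 1 < z.re} \ (↑(Sp ∪ S) : Set ℂ)) ∧
        ∀ z ∈ ({z : ℂ | 1 < z.re} \ (↑(Sp ∪ S) : Set ℂ)), ((Fam z : (quasiSplit (↥(maximalRealSubfield L)) L (IsCMField.complexConj L) 3).L2 μ) : (quasiSplit (↥(maximalRealSubfield L)) L (IsCMField.complexConj L) 3).automorphicQuotient → ℂ) =ᵐ[μ] (quasiSplit (↥(maximalRealSubfield L)) L (IsCMField.complexConj L) 3).quotFun (truncation ν 𝓕 T (Ec z)) := by
  intro K' ω φ hφ hφc Ec Sp hSp hEd hE2 Fp _hF _hFE f _hf ν hν 𝓕 h𝓕N h𝓕c hνi hν1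
  obtain ⟨Ec', P, S, hS, hPS, hEdiff', hE2', hE6'⟩ := hEXP6 K' ω φ hφ hφc ν hν 𝓕 h𝓕N h𝓕c hνi hν1
  exact hCONT_of_truncatedFamily_exports L μ Ec Sp hSp hEd hE2 ν 𝓕 hEdiff' hE2' hE6' hS hPS

/-- **ED. 2 — THE `hCONT` ROW OF ★ `res_midBlock_le_residual_of_admissible` FROM THE ADMISSIBLE EXPORTS ROW**: §1 with both ∀-rows restricted to the generator data `(K′, ω, φ)`
satisfying an admissibility predicate `Adm` (τ-admissible of S8-R199, 1-dim-admissible of S8-R197, or their union); per generator ★ (C4) `hCONT_of_truncatedFamily_exports` as in §1.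
[cite: MoeglinWaldspurger1995, IV.1.11, IV.2.3, V.3.13] [cite: BernsteinLapid2019, Thm 2.3, §4] [cite: Rogawski1990, §13.9 p. 229 (ii)] -/
theorem hCONT_admissible_row_of_exportsRow
    (μ : Measure (quasiSplit (↥(maximalRealSubfield L)) L (IsCMField.complexConj L) 3).automorphicQuotient) [(quasiSplit (↥(maximalRealSubfield L)) L (IsCMField.complexConj L) 3).IsAutomorphicMeasure μ]
    (μω : HeckeCharacter L) (ξ : OneDimAutRepH L)
    (Adm : ∀ K' : Subgroup (quasiSplit (↥(maximalRealSubfield L)) L (IsCMField.complexConj L) 3).Adelic, (↥K' →* ℂ) → ((quasiSplit (↥(maximalRealSubfield L)) L (IsCMField.complexConj L) 3).Adelic → ℂ) → Prop)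
    (hEXP6 : ∀ (K' : Subgroup (quasiSplit (↥(maximalRealSubfield L)) L (IsCMField.complexConj L) 3).Adelic) (ω : ↥K' →* ℂ)
      (φ : (quasiSplit (↥(maximalRealSubfield L)) L (IsCMField.complexConj L) 3).Adelic → ℂ) (_ : Adm K' ω φ) (_ : φ ∈ chiSectionSpacePair (ξ.bcη⁻¹ * ξ.bcψ⁻¹ * μω) ξ.ψ K' (ω : ↥K' → ℂ)) (_ : Continuous φ)
      (ν : Measure ↥(adelicUnipotent (↥(maximalRealSubfield L)) L (IsCMField.complexConj L) 3)) (_ : ν.IsHaarMeasure) (𝓕 : Set ↥(adelicUnipotent (↥(maximalRealSubfield L)) L (IsCMField.complexConj L) 3))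
      (_ : IsFundamentalDomain ↥(rationalUnipotent (↥(maximalRealSubfield L)) L (IsCMField.complexConj L) 3) 𝓕 ν) (_ : IsCompact (closure 𝓕)) (_ : ν.IsInvInvariant) (_ : ν 𝓕 = 1),
      ∃ (Ec' : ℂ → (quasiSplit (↥(maximalRealSubfield L)) L (IsCMField.complexConj L) 3).Adelic → ℂ) (P : Set ℂ) (S : Finset ℂ), (∀ s ∈ S, s.im = 0) ∧ P ∩ {z : ℂ | 1 < z.re} ⊆ (↑S : Set ℂ) ∧
        (∀ g, DifferentiableOn ℂ (fun z => Ec' z g) Pᶜ) ∧ (∀ z : ℂ, 2 < z.re → Ec' z = eisensteinSeriesU (flatSectionU φ z)) ∧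
        (∀ T : ℝ≥0, 1 ≤ T → ∃ Fam : ℂ → Lp ℂ 2 μ, DifferentiableOn ℂ Fam Pᶜ ∧
          ∀ z : ℂ, z ∉ P → ((Fam z : Lp ℂ 2 μ) : (quasiSplit (↥(maximalRealSubfield L)) L (IsCMField.complexConj L) 3).automorphicQuotient → ℂ) =ᵐ[μ] (quasiSplit (↥(maximalRealSubfield L)) L (IsCMField.complexConj L) 3).quotFun (truncation ν 𝓕 T (Ec' z)))) :
    ∀ (K' : Subgroup (quasiSplit (↥(maximalRealSubfield L)) L (IsCMField.complexConj L) 3).Adelic) (ω : ↥K' →* ℂ)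
      (φ : (quasiSplit (↥(maximalRealSubfield L)) L (IsCMField.complexConj L) 3).Adelic → ℂ) (_ : Adm K' ω φ) (_ : φ ∈ chiSectionSpacePair (ξ.bcη⁻¹ * ξ.bcψ⁻¹ * μω) ξ.ψ K' (ω : ↥K' → ℂ)) (_ : Continuous φ)
      (Ec : ℂ → (quasiSplit (↥(maximalRealSubfield L)) L (IsCMField.complexConj L) 3).Adelic → ℂ) (Sp : Finset ℂ) (_ : ∀ s ∈ Sp, s.im = 0 ∧ 1 < s.re ∧ s.re ≤ 2)
      (_ : ∀ g, DifferentiableOn ℂ (fun z => Ec z g) ({z : ℂ | 1 < z.re} \ (↑Sp : Set ℂ)))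
      (_ : ∀ z : ℂ, 2 < z.re → Ec z = eisensteinSeriesU (flatSectionU φ z))
      (Fp : (quasiSplit (↥(maximalRealSubfield L)) L (IsCMField.complexConj L) 3).Adelic → ℂ → ℂ) (_ : ∀ g, AnalyticAt ℂ (Fp g) ((3 : ℂ) / 2))
      (_ : ∀ g, Fp g =ᶠ[𝓝[≠] ((3 : ℂ) / 2)] fun z => (z - (3 : ℂ) / 2) * Ec z g)
      (f : (quasiSplit (↥(maximalRealSubfield L)) L (IsCMField.complexConj L) 3).L2 μ) (_ : (f : (quasiSplit (↥(maximalRealSubfield L)) L (IsCMField.complexConj L) 3).automorphicQuotient → ℂ) =ᵐ[μ] fun x => Fp (Quotient.out (x : (quasiSplit (↥(maximalRealSubfield L)) L (IsCMField.complexConj L) 3).Adelic ⧸ (quasiSplit (↥(maximalRealSubfield L)) L (IsCMField.complexConj L) 3).quotientSubgroup))⁻¹ ((3 : ℂ) / 2))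
      (ν : Measure ↥(adelicUnipotent (↥(maximalRealSubfield L)) L (IsCMField.complexConj L) 3)) (_ : ν.IsHaarMeasure) (𝓕 : Set ↥(adelicUnipotent (↥(maximalRealSubfield L)) L (IsCMField.complexConj L) 3)) (_ : IsFundamentalDomain ↥(rationalUnipotent (↥(maximalRealSubfield L)) L (IsCMField.complexConj L) 3) 𝓕 ν) (_ : IsCompact (closure 𝓕)) (_ : ν.IsInvInvariant) (_ : ν 𝓕 = 1),
      ∃ (T : ℝ≥0) (_ : 1 ≤ T) (S : Finset ℂ) (_ : ∀ s ∈ S, s.im = 0) (Fam : ℂ → (quasiSplit (↥(maximalRealSubfield L)) L (IsCMField.complexConj L) 3).L2 μ),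
        DifferentiableOn ℂ Fam ({z : ℂ | 1 < z.re} \ (↑(Sp ∪ S) : Set ℂ)) ∧
        ∀ z ∈ ({z : ℂ | 1 < z.re} \ (↑(Sp ∪ S) : Set ℂ)), ((Fam z : (quasiSplit (↥(maximalRealSubfield L)) L (IsCMField.complexConj L) 3).L2 μ) : (quasiSplit (↥(maximalRealSubfield L)) L (IsCMField.complexConj L) 3).automorphicQuotient → ℂ) =ᵐ[μ] (quasiSplit (↥(maximalRealSubfield L)) L (IsCMField.complexConj L) 3).quotFun (truncation ν 𝓕 T (Ec z)) := by
  intro K' ω φ hAdm hφ hφc Ec Sp hSp hEd hE2 Fp _hF _hFE f _hf ν hν 𝓕 h𝓕N h𝓕c hνi hν1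
  obtain ⟨Ec', P, S, hS, hPS, hEdiff', hE2', hE6'⟩ := hEXP6 K' ω φ hAdm hφ hφc ν hν 𝓕 h𝓕N h𝓕c hνi hν1
  exact hCONT_of_truncatedFamily_exports L μ Ec Sp hSp hEd hE2 ν 𝓕 hEdiff' hE2' hE6' hS hPS

end Summit.HodgeConjecture.HodgeConjecture.R90.S8

end
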